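import Summits.HodgeConjecture.HodgeConjecture.Theorems.CyclicUnitaryPowersFermatGeometricGenusBound
import HarnessLib

/-!
# Route A glue item `CyclicUnitaryPowers.VeryGeneralDeckCommutatorsInHgOfPLAndCDK` (stmt-HodgeConjecture-23153) —
# closed by transcription of prover-Bx's landed composition
# `CyclicUnitaryPowersFermatGeometricGenusBound.veryGeneralDeckCommutatorsInHg_of_localMonodromyBound_cdk`
# (= p624313 `veryGeneralDeckCommutatorsInHg_of_localMonodromyBound_fermatGenusLe` ∘ FGle p633147).

Prover seat `hodge-nonav-prover-Ax` (g11), cell `hodge-nonav`; statement drafted by the tenure planner (hodge-nonav-p3 g34).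
The glue is an implication between named statements; both hypotheses unfold definitionally to the hypotheses of the landed
theorem.  Nothing here says HC ∕ HC_AV is proved (the second hypothesis, Cattani–Deligne–Kaplan, is a print input).

## References

* [CarlsonToledo1999] J. A. Carlson, D. Toledo, Duke Math. J. 97 (1999), §6, §7 Theorem 7.1.
* [CattaniDeligneKaplan1995] E. Cattani, P. Deligne, A. Kaplan, On the locus of Hodge classes, J. Amer. Math. Soc. 8 (1995), Thm. 1.1, Cor. 1.2.
-/

set_option linter.dupNamespace false

namespace Summit.HodgeConjecture.HodgeConjecture.Theorems.CyclicUnitaryPowersVeryGeneralDeckCommutatorsInHgOfPLAndCDK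

/-- item stmt-HodgeConjecture-23153 (glue of the gen-1 split of K1-A):
`NodalMeridianLocalMonodromyBound → PrintCattaniDeligneKaplan → VeryGeneralDeckCommutatorsInHg`. -/
theorem veryGeneralDeckCommutatorsInHgOfPLAndCDK_holds :
    Summit.HodgeConjecture.HodgeConjecture.Theses.CyclicUnitaryPowers.VeryGeneralDeckCommutatorsInHgOfPLAndCDK :=
  fun hF1 hCDK =>
    Summit.HodgeConjecture.HodgeConjecture.Theorems.CyclicUnitaryPowersFermatGeometricGenusBound.veryGeneralDeckCommutatorsInHg_of_localMonodromyBound_cdk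
      hF1 @hCDK

end Summit.HodgeConjecture.HodgeConjecture.Theorems.CyclicUnitaryPowersVeryGeneralDeckCommutatorsInHgOfPLAndCDK
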